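import Mathlib.CategoryTheory.Groupoid
import Literature.IUT.HodgeArakelov.LocalTriMuDataIsoArch

/-!
# [IUTchII] Def 4.9 (vi)–(vii): the groupoids of `F^{⊢▶×μ}`- and `F^{⊢×μ}`-prime-strips over the Def 4.9 records,
# and the functor `F^{⊢▶×μ} ↦ F^{⊢×μ}`

Owner file (abc-iut cell, layer L6; abc-iut-L6-t2), sequel to `LocalTriMuDataIso.lean` /
`LocalTriMuDataIsoArch.lean`. S. Mochizuki, *Inter-universal Teichmüller theory II*, kurims Dec-2020 manuscript,
Def 4.9 (vi)–(vii) pp. 157–158: an `F^{⊢▶×μ}`-prime-strip is "a collection of data `*F^{⊢▶×μ} = {*F^{⊢▶×μ}_v}_{v ∈ V}`"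
of local data of the three types, an `F^{⊢×μ}`-prime-strip likewise with the `×μ`-data, and "a morphism of
`F^{⊢×}`-prime-strips (respectively, `F^{⊢×μ}`-prime-strips; `F^{⊢▶×μ}`-prime-strips) is defined to be a collection
of isomorphisms, indexed by `V`, between the various constituent objects of the prime-strips" — so these
prime-strips form GROUPOIDS, and "passing to `O^{×μ}`" is a functor. This is the shape in which the
[IUTchIII] §1–§2 frame (`Literature.IUT.LogThetaLattice.StripFrame`: `Fvtxm`, `Fxm`, `FvtxmToFxm`,
`iso_nonempty_Fxm`; bridge B10 part 2) consumes Def 4.9. Contents: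

* `Groupoid (FTriMuPrimeStrip P G X)` — `Hom := ∀ v, LocalTriMuDatum.Iso`, componentwise composition;
* `FTimesMuPrimeStrip P G X` — the `F^{⊢×μ}`-prime-strip determined by (the data of) an `F^{⊢▶×μ}`-prime-strip, as
  a one-field wrapper, with `Groupoid` structure `Hom := ∀ v, LocalTriMuDatum.MuIso`;
* `FTriMuPrimeStrip.toTimesMuFunctor : FTriMuPrimeStrip P G X ⥤ FTimesMuPrimeStrip P G X` (Def 4.9 (vi)–(vii)
  "passing to `×μ`"; = `StripFrame.FvtxmToFxm` shape);
* KIT-RULE connectedness: `iso_nonempty_of_model` — if every strip is isomorphic to a chosen model strip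
  (the printed "isomorphic to `‡F^{⊢▶×μ}_v`" clause of Def 4.9 (vii), supplied as a hypothesis on the family),
  then any two strips are isomorphic (the `StripFrame.iso_nonempty_Fxm` shape).

The `F^{⊩▶×μ}` groupoid (global realified Frobenioid + `ρ_v` + pilot object) is built over the Fintype-free
successor records in a sequel. Claim key `Mochizuki2012` DISPUTED (D-0012): definitions + bookkeeping;
nothing asserted.
-/

namespace Literature.IUT.HodgeArakelov

open CategoryTheory

universe u v w

variable {V : Type u} {P : PlaceData V} {G : V → Type u} [∀ v, Group (G v)]
  {X : ∀ v, GroupTheoreticUnits.{u, w} (G v)}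

/-! ### 1. The groupoid of `F^{⊢▶×μ}`-prime-strips -/

namespace FTriMuPrimeStrip

/-- **IUTchII Def 4.9 (vii) p. 158**: the groupoid of `F^{⊢▶×μ}`-prime-strips — a morphism `*F ⟶ *F'` is a
`V`-indexed collection of isomorphisms of the local data; composition, identities and inverses componentwise.
[cite: Mochizuki2012, Def 4.9 (vii) p.158] -/
instance instGroupoid : Groupoid (FTriMuPrimeStrip.{u, v, w} P G X) where
  Hom S T := ∀ v : V, LocalTriMuDatum.Iso (S.localDatum v) (T.localDatum v)
  id S := fun v => LocalTriMuDatum.Iso.refl (S.localDatum v)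
  comp f g := fun v => (f v).trans (g v)
  id_comp f := funext fun v => LocalTriMuDatum.Iso.refl_trans (f v)
  comp_id f := funext fun v => LocalTriMuDatum.Iso.trans_refl (f v)
  assoc f g h := funext fun v => LocalTriMuDatum.Iso.trans_assoc (f v) (g v) (h v)
  inv f := fun v => (f v).symm
  inv_comp f := funext fun v => LocalTriMuDatum.Iso.symm_trans (f v)
  comp_inv f := funext fun v => LocalTriMuDatum.Iso.trans_symm (f v)

/-- Morphisms are `V`-indexed collections of local isomorphisms (definitional unfolding).
[cite: Mochizuki2012, Def 4.9 (vii) p.158] -/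
theorem hom_eq (S T : FTriMuPrimeStrip.{u, v, w} P G X) :
    (S ⟶ T) = ∀ v : V, LocalTriMuDatum.Iso (S.localDatum v) (T.localDatum v) := rfl

/-- Composition is componentwise `trans`. (bookkeeping). [cite: Mochizuki2012, Def 4.9 (vii) p.158] -/
@[simp] theorem comp_apply {S T U : FTriMuPrimeStrip.{u, v, w} P G X} (f : S ⟶ T) (g : T ⟶ U) (v : V) :
    (f ≫ g) v = (f v).trans (g v) := rfl

/-- Identities are componentwise `refl`. (bookkeeping). [cite: Mochizuki2012, Def 4.9 (vii) p.158] -/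
@[simp] theorem id_apply (S : FTriMuPrimeStrip.{u, v, w} P G X) (v : V) :
    (𝟙 S : S ⟶ S) v = LocalTriMuDatum.Iso.refl (S.localDatum v) := rfl

/-- A collection of local isomorphisms IS an isomorphism in the groupoid. [cite: Mochizuki2012, Def 4.9 (vii) p.158] -/
def isoOfLocal {S T : FTriMuPrimeStrip.{u, v, w} P G X}
    (f : ∀ v : V, LocalTriMuDatum.Iso (S.localDatum v) (T.localDatum v)) : S ≅ T :=
  Groupoid.isoEquivHom S T |>.symm f

/-- KIT-RULE connectedness ([IUTchII] Def 4.9 (vii): every `F^{⊢▶×μ}`-prime-strip is "isomorphic to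
`‡F^{⊢▶×μ}`", the model): if every strip of a family is isomorphic to a fixed model strip then any two are
isomorphic (the `StripFrame.iso_nonempty_*` shape). [cite: Mochizuki2012, Def 4.9 (vii) p.158] -/
theorem iso_nonempty_of_model (M : FTriMuPrimeStrip.{u, v, w} P G X)
    (h : ∀ S : FTriMuPrimeStrip.{u, v, w} P G X, Nonempty (S ≅ M)) (S T : FTriMuPrimeStrip.{u, v, w} P G X) :
    Nonempty (S ≅ T) := by
  obtain ⟨e⟩ := h S
  obtain ⟨e'⟩ := h T
  exact ⟨e ≪≫ e'.symm⟩

end FTriMuPrimeStrip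

/-! ### 2. The groupoid of `F^{⊢×μ}`-prime-strips and the functor `F^{⊢▶×μ} ↦ F^{⊢×μ}` -/

/-- **An `F^{⊢×μ}`-prime-strip** ([IUTchII] Def 4.9 (vi)–(vii) p. 157: at each `v` the `×μ`-Kummer data
"`‡F^{⊢×μ}_v`" — `‡G ↷ O^{×μ}(‡A)` with the `×μ`-Kummer structure at nonarchimedean `v`, the Kummer-structured
circle at archimedean `v`), presented by the underlying collection of Def 4.9 (vi) local data (of which only the
`×μ`-part is seen by the morphisms below). [cite: Mochizuki2012, Def 4.9 (vii) p.157] -/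
structure FTimesMuPrimeStrip (P : PlaceData V) (G : V → Type u) [∀ v, Group (G v)]
    (X : ∀ v, GroupTheoreticUnits.{u, w} (G v)) : Type (max u (v + 1) w) where
  /-- the underlying collection of local data (its `×μ`-part is the `F^{⊢×μ}`-prime-strip) -/
  data : FTriMuPrimeStrip.{u, v, w} P G X

namespace FTimesMuPrimeStrip

/-- **IUTchII Def 4.9 (vii) p. 158**: the groupoid of `F^{⊢×μ}`-prime-strips — a morphism is a `V`-indexed
collection of isomorphisms of the `×μ`-data (`LocalTriMuDatum.MuIso`). [cite: Mochizuki2012, Def 4.9 (vii) p.158] -/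
instance instGroupoid : Groupoid (FTimesMuPrimeStrip.{u, v, w} P G X) where
  Hom S T := ∀ v : V, LocalTriMuDatum.MuIso (S.data.localDatum v) (T.data.localDatum v)
  id S := fun v => LocalTriMuDatum.MuIso.refl (S.data.localDatum v)
  comp f g := fun v => (f v).trans (g v)
  id_comp f := funext fun v => LocalTriMuDatum.MuIso.refl_trans (f v)
  comp_id f := funext fun v => LocalTriMuDatum.MuIso.trans_refl (f v)
  assoc f g h := funext fun v => LocalTriMuDatum.MuIso.trans_assoc (f v) (g v) (h v)
  inv f := fun v => (f v).symm
  inv_comp f := funext fun v => LocalTriMuDatum.MuIso.symm_trans (f v)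
  comp_inv f := funext fun v => LocalTriMuDatum.MuIso.trans_symm (f v)

/-- Morphisms are `V`-indexed collections of `×μ`-isomorphisms (definitional unfolding).
[cite: Mochizuki2012, Def 4.9 (vii) p.158] -/
theorem hom_eq (S T : FTimesMuPrimeStrip.{u, v, w} P G X) :
    (S ⟶ T) = ∀ v : V, LocalTriMuDatum.MuIso (S.data.localDatum v) (T.data.localDatum v) := rfl

/-- Composition is componentwise `trans`. (bookkeeping). [cite: Mochizuki2012, Def 4.9 (vii) p.158] -/
@[simp] theorem comp_apply {S T U : FTimesMuPrimeStrip.{u, v, w} P G X} (f : S ⟶ T) (g : T ⟶ U) (v : V) :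
    (f ≫ g) v = (f v).trans (g v) := rfl

/-- Identities are componentwise `refl`. (bookkeeping). [cite: Mochizuki2012, Def 4.9 (vii) p.158] -/
@[simp] theorem id_apply (S : FTimesMuPrimeStrip.{u, v, w} P G X) (v : V) :
    (𝟙 S : S ⟶ S) v = LocalTriMuDatum.MuIso.refl (S.data.localDatum v) := rfl

/-- KIT-RULE connectedness for `F^{⊢×μ}`-prime-strips ("isomorphic to `‡F^{⊢×μ}_v`", Def 4.9 (vii); the
`StripFrame.iso_nonempty_Fxm` shape). [cite: Mochizuki2012, Def 4.9 (vii) p.158] -/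
theorem iso_nonempty_of_model (M : FTimesMuPrimeStrip.{u, v, w} P G X)
    (h : ∀ S : FTimesMuPrimeStrip.{u, v, w} P G X, Nonempty (S ≅ M)) (S T : FTimesMuPrimeStrip.{u, v, w} P G X) :
    Nonempty (S ≅ T) := by
  obtain ⟨e⟩ := h S
  obtain ⟨e'⟩ := h T
  exact ⟨e ≪≫ e'.symm⟩

end FTimesMuPrimeStrip

namespace FTriMuPrimeStrip

/-- **"Passing to `O^{×μ}`" as a functor `F^{⊢▶×μ} ⥤ F^{⊢×μ}`** ([IUTchII] Def 4.9 (vi)–(vii): the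
`F^{⊢×μ}`-prime-strip determined by an `F^{⊢▶×μ}`-prime-strip, functorially in isomorphisms — the
`StripFrame.FvtxmToFxm` shape). [cite: Mochizuki2012, Def 4.9 (vii) p.158] -/
def toTimesMuFunctor : FTriMuPrimeStrip.{u, v, w} P G X ⥤ FTimesMuPrimeStrip.{u, v, w} P G X where
  obj S := ⟨S⟩
  map f := fun v => (f v).toMuIso
  map_id S := funext fun v => LocalTriMuDatum.Iso.toMuIso_refl (S.localDatum v)
  map_comp f g := funext fun v => LocalTriMuDatum.Iso.toMuIso_trans (f v) (g v)

/-- On objects the functor keeps the underlying data. [cite: Mochizuki2012, Def 4.9 (vii) p.158] -/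
@[simp] theorem toTimesMuFunctor_obj (S : FTriMuPrimeStrip.{u, v, w} P G X) :
    (toTimesMuFunctor.obj S).data = S := rfl

/-- On morphisms it is componentwise `toMuIso`. [cite: Mochizuki2012, Def 4.9 (vii) p.158] -/
@[simp] theorem toTimesMuFunctor_map {S T : FTriMuPrimeStrip.{u, v, w} P G X} (f : S ⟶ T) (v : V) :
    (toTimesMuFunctor.map f) v = (f v).toMuIso := rfl

end FTriMuPrimeStrip

end Literature.IUT.HodgeArakelov
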